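import Summits.QuantumFields.YangMills.Theses.LevelShiftBootstrap

/-!
# Crux `HistoryTailL` (stmt-QuantumFields-19936) — LINE «level-shift-bootstrap» (ideator seat ym-r3-idea-2 g3, lens «nearmiss»)

The line IS route `LevelShiftBootstrap` (route-QuantumFields-LevelShiftBootstrap, OPEN; critic idea-crit-5 VERDICT #67 PASS-WITH-PRICE): its crux
`LocalUnitStabilityL` (stmt-QuantumFields-27016, rank 2, v4 text: CONDITIONAL, LOCAL one-step unit-scale stability of the interior-conditioned
unit-plaquette tail under the level shift `J ↦ J+1`, with a level-dependent increment budget) and its glue `HistoryTailOfLocalStability`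
(stmt-QuantumFields-26949, support r9: the bootstrap over the cut-off that turns one-step local stability into the summable history profile —
CLAIMED by prover ym-line-sfw-p2-w3, helper ✓p623479) give `UnitScaleTilt.HistoryTailL`.  Both stubs are those items BY NAME (shared, not re-typed).

How it differs from `Lines/renyi_telescope.lean` (same seat): a SUP-type one-step comparison with an explicit per-level increment (the near-miss of
King's sup-norm convergence, localised and conditioned), where «renyi-telescope» uses an (q−1)-weighted divergence at the CLT scale; from the LEAD's
`birth_v5p*`: no α-record / χ data rows.

WHAT THIS IS NOT: neither stub is proved; `HistoryTailL`, the rung R3 `YM3TorusSU2` and the mass gap are NOT proved.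
-/

namespace Summit.QuantumFields.YangMills.Cruxes.HistoryTailL.LevelShiftBootstrap

/-! ## §1 The registered stubs (the ONLY sorries) -/

/-- stub (XL, = item stmt-QuantumFields-27016 `LocalUnitStabilityL`, rank 2 of route `LevelShiftBootstrap`; own skeleton bc/LocalUnitStabilityL_birth_v4.lean). -/
theorem stub_localUnitStability : Summit.QuantumFields.YangMills.Theses.LevelShiftBootstrap.LocalUnitStabilityL := by
  sorry

/-- stub (L, = item stmt-QuantumFields-26949 `HistoryTailOfLocalStability`, support r9 of route `LevelShiftBootstrap`; prover ym-line-sfw-p2-w3 on it). -/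
theorem stub_historyTailOfLocalStability :
    Summit.QuantumFields.YangMills.Theses.LevelShiftBootstrap.HistoryTailOfLocalStability := by
  sorry

/-! ## §2 The crux BY NAME — no sorry below this line -/

/-- `LocalUnitStabilityL → (LocalUnitStabilityL → HistoryTailL) → HistoryTailL`. -/
theorem historyTailL_of_stubs
    (h₁ : Summit.QuantumFields.YangMills.Theses.LevelShiftBootstrap.LocalUnitStabilityL)
    (h₂ : Summit.QuantumFields.YangMills.Theses.LevelShiftBootstrap.HistoryTailOfLocalStability) :
    Summit.QuantumFields.YangMills.Theses.UnitScaleTilt.HistoryTailL :=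
  h₂ h₁

/-- The crux of route `UnitScaleTilt` BY NAME, from the two stubs. -/
theorem HistoryTailL_of : Summit.QuantumFields.YangMills.Theses.UnitScaleTilt.HistoryTailL :=
  historyTailL_of_stubs stub_localUnitStability stub_historyTailOfLocalStability

end Summit.QuantumFields.YangMills.Cruxes.HistoryTailL.LevelShiftBootstrap
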